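import Mathlib.Data.Nat.Prime.Basic
import Mathlib.Tactic.LinearCombination
import Literature.Computability.Complexity.CNFRelabel
import HarnessLib

/-!
# The multiplier CNF `mulCNF n N`: "`N` is a product of two `n`-bit numbers `≠ 1`"

The CNF behind the Krajíček–Pudlák *primality tautologies*. Krajíček and Pudlák
[KrajicekPudlak1998, §1 (before Prop. 2)] put `Composite(a) := ∃ u, v < a, u · v = a` and consider
the propositional translations `τ_p := ‖¬Composite(a)‖(p̃)` of the true `Π^b_1`-sentences
`¬Composite(p)`, `p` prime [KrajicekPudlak1998, §4, Thm. 12], asking whether they have short `EF`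
proofs ("We do not know any lower bounds for the tautologies in any proof system", loc. cit.).

This file fixes ONE concrete clausal translation, suitable for resolution / polynomial calculus:
`mulCNF n N : CNF ℕ` is the Tseitin-style CNF of the schoolbook `n × n` ARRAY MULTIPLIER (rows of
full adders accumulating the partial products `xᵢ ∧ yⱼ`, every wire a propositional variable,
every gate the clauses of its truth table), with the `2n` output wires fixed to the binary digits
of `N` by unit clauses, plus the two clauses `x ≠ 1`, `y ≠ 1` (`¬x₀ ∨ x₁ ∨ ⋯ ∨ x_{n-1}`, same for
`y`). Main facts (all proved):

* `mulCNF_satisfiable_iff`: `mulCNF n N` is satisfiable iff `∃ x, y < 2ⁿ, x ≠ 1 ∧ y ≠ 1 ∧ x·y = N mod 2²ⁿ`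
  (`mulCNF_satisfiable_iff_of_lt`: `… ∧ x·y = N` when `N < 2²ⁿ`);
* `mulCNF_not_satisfiable_iff_prime`: for `2 ≤ N < 2ⁿ`, `mulCNF n N` is unsatisfiable iff `N` is prime
  (so refutations of `mulCNF n p` are propositional primality proofs of `p`);
* `isWidthLE_mulCNF`: width `≤ max n 4` (the multiplier part has width `≤ 4`; only the two
  "`≠ 1`" clauses are wide); `length_mulCNF`: exactly `20 n² + 2 n + 3` clauses for `0 < n`;
  `fst_lt_of_mem_mulCNF` / `numVars_mulCNF_le`: all variables (`zeroVar`, `xVar`, `yVar`,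
  `ppVar`, `sumVar`, `carryVar`) are `< 6 n²` (tight: `carryVar n (n-1) (n-1) = 6n² - 1`).

## The circuit (schoolbook / array multiplier, e.g. [Wegener 1987, §3.2]; here [folklore])

Inputs `x = Σ_{i<n} xᵢ 2ⁱ`, `y = Σ_{j<n} yⱼ 2ʲ`. Row `j < n` is a ripple-carry adder of `n` full
adders: cell `(j, i)` adds the accumulated bit `aIn n j i`, the partial product `ppVar n j i ↔ xᵢ ∧ yⱼ`
and the carry-in `cIn n j i` (the carry-out of cell `(j, i-1)`, the constant-`0` wire `zeroVar` for
`i = 0`) into a sum bit `sumVar n j i` and a carry-out `carryVar n j i`. Row `0` accumulates onto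
`0` (`aIn n 0 i = zeroVar`); row `j + 1` accumulates onto row `j`'s output shifted right by one:
`aIn n (j+1) i = sumVar n j (i+1)` for `i + 1 < n` and `= carryVar n j (n-1)` (row `j`'s top carry)
for `i = n - 1`. The product bits are `sumVar n t 0` (`t < n - 1`), then `sumVar n (n-1) i`
(`i < n`), then `carryVar n (n-1) (n-1)` — the list `outVars n` of length `2n`. Invariant
(`Gadgets.acc_eq`): `2ʲ · (row j output) + Σ_{t<j} sum_{t,0} 2ᵗ = x · (y mod 2ʲ⁺¹)`.

## Design notes

* Gates are compiled by the generic `relCNF vs R` (one blocking clause per assignment of the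
  listed variables violating `R`; `eval_relCNF_iff` needs no distinctness of `vs`), so AND / XOR₃ /
  MAJ₃ cost `4 + 8 + 8 = 20` clauses of width `≤ 4` per cell; no auxiliary variables beyond wires.
  Related tree constructions deliberately NOT reused: `MetaComplexity.canonicalCNF V P`
  (`FpLinearSystems.lean`: the constraint is a predicate on the SET of true variables and its
  semantics needs `V.Nodup`, i.e. wire-distinctness proofs; it also lives one layer up) and
  `ThreeCNF.Con` (`ThreeCNFCompiler.lean`: width-`3` blocks with `256` auxiliary variables per
  constraint, for the succinct Cook–Levin reduction). `relCNF` takes the relation positionally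
  on the value vector, which is what gate equations `out = g(in₁, …)` want.
* Variables: `zeroVar = 0`, `xVar i = 6i+1`, `yVar j = 6j+2`, and cell `(j,i)` owns
  `6(nj+i)+3,4,5` (partial product, sum, carry); `witness n x y` decodes a variable by `v % 6`,
  `v / 6 / n`, `v / 6 % n` (valid for `i < n`), which is all the injectivity the proofs need.
* Output bits are fixed to `N mod 2²ⁿ` (`fixBits`), so no side condition on `N` is baked into the
  definition; `N ≥ 2²ⁿ` is handled by the `_of_lt` / `_prime` corollaries' hypotheses.
* `n = 0`: no cells, no "`≠ 1`" clauses (the empty number is `0 ≠ 1`), `mulCNF 0 N = [[¬zeroVar]]`,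
  satisfiable, matching `0 · 0 = N mod 1`. The `ℕ`-subtractions `n - 1` in `aIn`/`rowVal` only
  occur under `0 < n`.
* Krajíček–Pudlák bound the factors by `u, v < a`; for `x · y = N ≥ 1` this is equivalent to
  `x, y ≠ 1`, the form requested for this CNF (idea card PneNP/primes-dyadic-archimedean); other
  clausal translations of `¬Composite` are equivalent up to polynomial-size `EF`, not necessarily
  for weak systems. A companion encoding of general `{+, ×}`-circuits ("`F(x̄) = c`") is NOT here.

## References

* J. Krajíček, P. Pudlák, *Some consequences of cryptographical conjectures for `S¹₂` and `EF`*,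
  Inform. and Comput. 140 (1998) 82–94, §1 (`Composite(a)`), §4 Thm. 12 (the tautologies `τ_p`)
  [KrajicekPudlak1998].
* G. S. Tseitin, *On the complexity of derivation in propositional calculus*, 1968 (clausal
  translation of circuits) [Tseitin1968].
* S. Arora, B. Barak, *Computational Complexity*, CUP 2009, Def. 2.9, Claim 2.13
  (truth-table CNF of a Boolean function on few variables) [AroraBarak2009].
-/

namespace Literature.Computability.Complexity

open _root_.Computability

/-! ### Numbers from bit sequences -/

/-- The number with binary digits `F 0, …, F (m-1)` (least significant first):
`natOfBits F m = bitsToNat [F 0, …, F (m-1)] = Σ_{i<m} (F i) 2ⁱ`. [folklore] -/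
def natOfBits (F : ℕ → Bool) (m : ℕ) : ℕ :=
  bitsToNat ((List.range m).map F)

/-- `natOfBits F 0 = 0`. [folklore] -/
@[simp] theorem natOfBits_zero (F : ℕ → Bool) : natOfBits F 0 = 0 := by
  simp [natOfBits]

/-- High-end recursion: `natOfBits F (m+1) = natOfBits F m + 2ᵐ · F m`. [folklore] -/
theorem natOfBits_succ (F : ℕ → Bool) (m : ℕ) :
    natOfBits F (m + 1) = natOfBits F m + 2 ^ m * (F m).toNat := by
  simp [natOfBits, List.range_succ, bitsToNat_append]

/-- Low-end recursion: `natOfBits F (m+1) = F 0 + 2 · natOfBits (F ∘ succ) m`. [folklore] -/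
theorem natOfBits_succ' (F : ℕ → Bool) (m : ℕ) :
    natOfBits F (m + 1) = (F 0).toNat + 2 * natOfBits (fun i => F (i + 1)) m := by
  simp [natOfBits, List.range_succ_eq_map, List.map_map, Function.comp_def]

/-- `natOfBits F m < 2ᵐ`. [folklore] -/
theorem natOfBits_lt (F : ℕ → Bool) (m : ℕ) : natOfBits F m < 2 ^ m := by
  simpa [natOfBits] using bitsToNat_lt ((List.range m).map F)

/-- `natOfBits F m` only depends on `F i` for `i < m`. [folklore] -/
theorem natOfBits_congr {F G : ℕ → Bool} {m : ℕ} (h : ∀ i < m, F i = G i) :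
    natOfBits F m = natOfBits G m := by
  unfold natOfBits
  rw [List.map_congr_left (fun i hi => h i (List.mem_range.1 hi))]

/-- The all-zero bit sequence has value `0`. [folklore] -/
@[simp] theorem natOfBits_false (m : ℕ) : natOfBits (fun _ => false) m = 0 := by
  simp [natOfBits, List.map_const']

/-- `bitsToNat l = 0` iff all digits are `0`. [folklore] -/
theorem bitsToNat_eq_zero_iff (l : List Bool) : bitsToNat l = 0 ↔ ∀ b ∈ l, b = false := by
  induction l with
  | nil => simp
  | cons b l ih => cases b <;> simp [ih]

/-- Masking every digit by `b` multiplies the value by `b`. [folklore] -/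
theorem natOfBits_and (F : ℕ → Bool) (b : Bool) (m : ℕ) :
    natOfBits (fun i => F i && b) m = b.toNat * natOfBits F m := by
  cases b <;> simp [natOfBits, List.map_const']

/-- The first `m` binary digits of `x` have value `x mod 2ᵐ`. [folklore] -/
theorem natOfBits_testBit (x m : ℕ) : natOfBits x.testBit m = x % 2 ^ m := by
  induction m with
  | zero => simp [Nat.mod_one]
  | succ m ih => rw [natOfBits_succ, ih, Nat.mod_pow_succ, Nat.toNat_testBit]

/-- **Ripple-carry adders add.** If bits `a i, p i, s i` and carries `κ i` satisfy the full-adder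
relation `a i + p i + κ i = s i + 2 κ (i+1)` for all `i < m`, then
`Σ aᵢ2ⁱ + Σ pᵢ2ⁱ + κ 0 = Σ sᵢ2ⁱ + 2ᵐ κ m`. [folklore] -/
theorem ripple_adder {a p s κ : ℕ → Bool} {m : ℕ}
    (h : ∀ i < m, (a i).toNat + (p i).toNat + (κ i).toNat = (s i).toNat + 2 * (κ (i + 1)).toNat) :
    natOfBits a m + natOfBits p m + (κ 0).toNat = natOfBits s m + 2 ^ m * (κ m).toNat := by
  induction m with
  | zero => simp
  | succ m ih =>
    have ih' := ih fun i hi => h i (Nat.lt_succ_of_lt hi)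
    have hm := h m (Nat.lt_succ_self m)
    simp only [natOfBits_succ, pow_succ]
    linear_combination ih' + 2 ^ m * hm

/-- The arithmetic of one full adder: `a + b + c = (a ⊕ b ⊕ c) + 2 · maj(a, b, c)`. [folklore] -/
theorem fullAdder_arith (a b c : Bool) :
    a.toNat + b.toNat + c.toNat
      = ((a ^^ b) ^^ c).toNat + 2 * (a && b || a && c || b && c).toNat := by
  revert a b c
  decide

/-! ### Generic gadgets: the CNF of a Boolean relation, bit fixing, "`≠ 1`" -/

/-- All Boolean vectors of length `k`, listed (as lists). [folklore] -/
def boolVecs : ℕ → List (List Bool)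
  | 0 => [[]]
  | k + 1 => (boolVecs k).flatMap fun α => [false :: α, true :: α]

/-- `boolVecs k` lists exactly the vectors of length `k`. [folklore] -/
theorem mem_boolVecs_iff {k : ℕ} {α : List Bool} : α ∈ boolVecs k ↔ α.length = k := by
  induction k generalizing α with
  | zero => cases α <;> simp [boolVecs]
  | succ k ih =>
    cases α with
    | nil => simp [boolVecs]
    | cons b α =>
      simp only [boolVecs, List.mem_flatMap, List.mem_cons, List.cons.injEq, List.not_mem_nil,
        or_false, List.length_cons, Nat.add_right_cancel_iff]
      constructor
      · rintro ⟨β, hβ, ⟨-, rfl⟩ | ⟨-, rfl⟩⟩ <;> exact ih.1 hβ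
      · intro h
        refine ⟨α, ih.2 h, ?_⟩
        cases b <;> simp

/-- There are `2ᵏ` Boolean vectors of length `k`. [folklore] -/
theorem length_boolVecs (k : ℕ) : (boolVecs k).length = 2 ^ k := by
  induction k with
  | zero => rfl
  | succ k ih => simp [boolVecs, List.length_flatMap, List.map_const', ih, pow_succ, mul_comm]

/-- The clause on the variables `vs` falsified exactly by the assignments giving `vs` the values
`α` (positionally): `⋁ₜ vsₜ^{1-αₜ}`, i.e. the literal `(vsₜ, ¬αₜ)` for each position `t`.
[Arora–Barak 2009, proof of Claim 2.13 (blocking clause of a row of the truth table)]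
[cite: AroraBarak2009, Claim 2.13] -/
def clauseAgainst (vs : List ℕ) (α : List Bool) : Clause ℕ :=
  List.zipWith (fun v a => (v, !a)) vs α

/-- `clauseAgainst vs α` has at most `|vs|` literals. [folklore] -/
theorem length_clauseAgainst_le (vs : List ℕ) (α : List Bool) :
    (clauseAgainst vs α).length ≤ vs.length := by
  simp [clauseAgainst, List.length_zipWith]

/-- `clauseAgainst vs α` is true under `σ` iff `σ` does not give `vs` the values `α`.
[Arora–Barak 2009, proof of Claim 2.13] [cite: AroraBarak2009, Claim 2.13] -/
theorem eval_clauseAgainst_iff (σ : ℕ → Bool) {vs : List ℕ} {α : List Bool}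
    (h : α.length = vs.length) :
    Clause.eval σ (clauseAgainst vs α) = true ↔ vs.map σ ≠ α := by
  induction vs generalizing α with
  | nil =>
    cases α with
    | nil => simp [clauseAgainst, Clause.eval]
    | cons _ _ => simp at h
  | cons v vs ih =>
    cases α with
    | nil => simp at h
    | cons a α =>
      simp only [List.length_cons, Nat.add_right_cancel_iff] at h
      have ih' := ih h
      simp only [clauseAgainst, Clause.eval] at ih'
      simp only [clauseAgainst, Clause.eval, List.zipWith_cons_cons, List.any_cons,
        Bool.or_eq_true, ih', List.map_cons, ne_eq, List.cons.injEq, not_and_or, Literal.eval]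
      cases a <;> cases σ v <;> simp

/-- The CNF of a Boolean relation `R` on the variables `vs` (a "gate" or local constraint):
one blocking clause `clauseAgainst vs α` for every `α ∈ {0,1}^{|vs|}` with `R α = false`; width
`|vs|`, at most `2^{|vs|}` clauses. This is the clausal (Tseitin-style) translation of a gate
when `R` says "the output variable equals the gate applied to the input variables".
[Arora–Barak 2009, Claim 2.13 (CNF of a function on few variables); Tseitin 1968]
[cite: AroraBarak2009, Claim 2.13] -/
def relCNF (vs : List ℕ) (R : List Bool → Bool) : CNF ℕ :=
  ((boolVecs vs.length).filter fun α => !R α).map (clauseAgainst vs)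

/-- **`relCNF vs R` means `R`**: it is true under `σ` iff `R` holds of the values of `vs`.
(No distinctness of `vs` is needed: clauses against unrealizable `α` are tautologies.)
[Arora–Barak 2009, proof of Claim 2.13] [cite: AroraBarak2009, Claim 2.13] -/
theorem eval_relCNF_iff (σ : ℕ → Bool) (vs : List ℕ) (R : List Bool → Bool) :
    (relCNF vs R).eval σ = true ↔ R (vs.map σ) = true := by
  rw [CNF.eval_eq_true_iff]
  simp only [relCNF, List.mem_map, List.mem_filter, mem_boolVecs_iff, forall_exists_index,
    and_imp]
  constructor
  · intro h
    by_contra hR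
    have h1 := h _ (vs.map σ) (by simp) (by simpa using hR) rfl
    exact (eval_clauseAgainst_iff σ (by simp)).1 h1 rfl
  · rintro hR c α hlen hα rfl
    refine (eval_clauseAgainst_iff σ hlen).2 ?_
    rintro rfl
    simp [hR] at hα

/-- `relCNF vs R` has width `≤ |vs|`. [folklore] -/
theorem isWidthLE_relCNF (vs : List ℕ) (R : List Bool → Bool) :
    (relCNF vs R).IsWidthLE vs.length := by
  intro c hc
  simp only [relCNF, List.mem_map, List.mem_filter] at hc
  obtain ⟨α, -, rfl⟩ := hc
  exact length_clauseAgainst_le vs α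

/-- `relCNF vs R` has at most `2^{|vs|}` clauses. [folklore] -/
theorem length_relCNF_le (vs : List ℕ) (R : List Bool → Bool) :
    (relCNF vs R).length ≤ 2 ^ vs.length := by
  simp only [relCNF, List.length_map]
  exact (List.length_filter_le _ _).trans (length_boolVecs _).le

/-- The variables of `clauseAgainst vs α` are among `vs`. [folklore] -/
theorem fst_mem_of_mem_clauseAgainst {vs : List ℕ} {α : List Bool} {l : Literal ℕ}
    (h : l ∈ clauseAgainst vs α) : l.1 ∈ vs := by
  induction vs generalizing α with
  | nil => simp [clauseAgainst] at h
  | cons v vs ih =>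
    cases α with
    | nil => simp [clauseAgainst] at h
    | cons a α =>
      simp only [clauseAgainst, List.zipWith_cons_cons, List.mem_cons] at h
      rcases h with rfl | h
      · simp
      · exact List.mem_cons_of_mem _ (ih h)

/-- The variables of `relCNF vs R` are among `vs`. [folklore] -/
theorem fst_mem_of_mem_relCNF {vs : List ℕ} {R : List Bool → Bool} {c : Clause ℕ} {l : Literal ℕ}
    (hc : c ∈ relCNF vs R) (hl : l ∈ c) : l.1 ∈ vs := by
  simp only [relCNF, List.mem_map, List.mem_filter] at hc
  obtain ⟨α, -, rfl⟩ := hc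
  exact fst_mem_of_mem_clauseAgainst hl

/-- Unit clauses fixing the variables `vs = [v₀, v₁, …]` to the binary digits of `N`, least
significant first (`vₜ ↦ bit t of N`); digits of `N` beyond `|vs|` are ignored. [folklore] -/
def fixBits : List ℕ → ℕ → CNF ℕ
  | [], _ => []
  | v :: vs, N => [(v, decide (N % 2 = 1))] :: fixBits vs (N / 2)

/-- `fixBits vs N` has `|vs|` clauses. [folklore] -/
theorem length_fixBits (vs : List ℕ) (N : ℕ) : (fixBits vs N).length = vs.length := by
  induction vs generalizing N with
  | nil => rfl
  | cons v vs ih => simp [fixBits, ih]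

/-- `fixBits vs N` consists of unit clauses. [folklore] -/
theorem isWidthLE_fixBits (vs : List ℕ) (N : ℕ) : (fixBits vs N).IsWidthLE 1 := by
  induction vs generalizing N with
  | nil => intro c hc; simp [fixBits] at hc
  | cons v vs ih =>
    intro c hc
    simp only [fixBits, List.mem_cons] at hc
    rcases hc with rfl | hc
    · simp
    · exact ih _ c hc

/-- The variables of `fixBits vs N` are among `vs`. [folklore] -/
theorem fst_mem_of_mem_fixBits {vs : List ℕ} {N : ℕ} {c : Clause ℕ} {l : Literal ℕ}
    (hc : c ∈ fixBits vs N) (hl : l ∈ c) : l.1 ∈ vs := by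
  induction vs generalizing N with
  | nil => simp [fixBits] at hc
  | cons v vs ih =>
    simp only [fixBits, List.mem_cons] at hc
    rcases hc with rfl | hc
    · simp only [List.mem_singleton] at hl
      simp [hl]
    · exact List.mem_cons_of_mem _ (ih hc)

/-- **`fixBits vs N` means "the number on the wires `vs` is `N mod 2^{|vs|}`"**. [folklore] -/
theorem eval_fixBits_iff (σ : ℕ → Bool) (vs : List ℕ) (N : ℕ) :
    (fixBits vs N).eval σ = true ↔ bitsToNat (vs.map σ) = N % 2 ^ vs.length := by
  induction vs generalizing N with
  | nil => simp [fixBits, Nat.mod_one]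
  | cons v vs ih =>
    rw [fixBits, CNF.eval_cons, Bool.and_eq_true, ih, List.map_cons, bitsToNat_cons,
      List.length_cons, Nat.pow_succ', Nat.mod_mul]
    have hv : Clause.eval σ [(v, decide (N % 2 = 1))] = true ↔ (σ v).toNat = N % 2 := by
      cases h : σ v <;> simp [Clause.eval, Literal.eval, h] <;> omega
    rw [hv]
    have h2 := bitsToNat_lt (vs.map σ)
    have h3 := Nat.mod_lt (N / 2) (Nat.two_pow_pos vs.length)
    rw [List.length_map] at h2
    constructor
    · rintro ⟨h0, h1⟩
      rw [h0, h1]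
    · intro h
      have hb := Bool.toNat_le (σ v)
      constructor <;> omega

/-- The CNF saying that the number with binary digits on the variables `x 0, …, x (n-1)` (least
significant first) is not `1`: the single clause `¬x₀ ∨ x₁ ∨ ⋯ ∨ x_{n-1}` for `0 < n`, and no
clause for `n = 0` (the empty number is `0 ≠ 1`). [folklore] -/
def neOneCNF (x : ℕ → ℕ) : ℕ → CNF ℕ
  | 0 => []
  | n + 1 => [(x 0, false) :: (List.range n).map fun i => (x (i + 1), true)]

/-- **`neOneCNF x n` means "`Σ_{i<n} σ(x i) 2ⁱ ≠ 1`"**. [folklore] -/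
theorem eval_neOneCNF_iff (σ : ℕ → Bool) (x : ℕ → ℕ) (n : ℕ) :
    (neOneCNF x n).eval σ = true ↔ natOfBits (fun i => σ (x i)) n ≠ 1 := by
  cases n with
  | zero => simp [neOneCNF]
  | succ n =>
    rw [natOfBits_succ']
    have key : (neOneCNF x (n + 1)).eval σ = true ↔
        σ (x 0) = false ∨ ∃ i < n, σ (x (i + 1)) = true := by
      simp [neOneCNF, Clause.eval, Literal.eval]
    rw [key]
    have hz := bitsToNat_eq_zero_iff ((List.range n).map fun i => σ (x (i + 1)))
    simp only [List.forall_mem_map, List.mem_range] at hz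
    unfold natOfBits
    cases h0 : σ (x 0)
    · simp only [Bool.toNat_false, zero_add, true_or, true_iff]
      omega
    · have hB : (true : Bool).toNat + 2 * bitsToNat ((List.range n).map fun i => σ (x (i + 1)))
          ≠ 1 ↔ ¬ bitsToNat ((List.range n).map fun i => σ (x (i + 1))) = 0 := by
        simp only [Bool.toNat_true]
        omega
      rw [hB, hz]
      simp

/-- `neOneCNF x n` has at most one clause, of width `n`. [folklore] -/
theorem isWidthLE_neOneCNF (x : ℕ → ℕ) (n : ℕ) : (neOneCNF x n).IsWidthLE n := by
  cases n with
  | zero => intro c hc; simp [neOneCNF] at hc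
  | succ n => intro c hc; simp only [neOneCNF, List.mem_singleton] at hc; subst hc; simp

/-- `neOneCNF x n` has `min n 1` clauses. [folklore] -/
theorem length_neOneCNF (x : ℕ → ℕ) (n : ℕ) : (neOneCNF x n).length = min n 1 := by
  cases n <;> simp [neOneCNF]

/-- The variables of `neOneCNF x n` are `x k`, `k < n`. [folklore] -/
theorem exists_eq_of_mem_neOneCNF {x : ℕ → ℕ} {n : ℕ} {c : Clause ℕ} {l : Literal ℕ}
    (hc : c ∈ neOneCNF x n) (hl : l ∈ c) : ∃ k < n, l.1 = x k := by
  cases n with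
  | zero => simp [neOneCNF] at hc
  | succ n =>
    simp only [neOneCNF, List.mem_singleton] at hc
    subst hc
    simp only [List.mem_cons, List.mem_map, List.mem_range] at hl
    rcases hl with rfl | ⟨i, hi, rfl⟩
    · exact ⟨0, by omega, rfl⟩
    · exact ⟨i + 1, by omega, rfl⟩

/-- A CNF all of whose variables are `< B` has `numVars ≤ B`. [folklore] -/
theorem CNF.numVars_le_of_forall_lt {φ : CNF ℕ} {B : ℕ} (h : ∀ c ∈ φ, ∀ l ∈ c, l.1 < B) :
    φ.numVars ≤ B := by
  unfold CNF.numVars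
  have key : ∀ L : List ℕ, (∀ v ∈ L, v ≤ B) → L.foldr max 0 ≤ B := by
    intro L hL
    induction L with
    | nil => simp
    | cons a L ih =>
      simp only [List.foldr_cons]
      exact max_le (hL a (by simp)) (ih fun v hv => hL v (by simp [hv]))
  refine key _ fun v hv => ?_
  simp only [List.mem_map, List.mem_flatten] at hv
  obtain ⟨l, ⟨c, hc, hl⟩, rfl⟩ := hv
  exact h c hc l hl

/-- `CNF.eval` of a `flatMap`. [folklore] -/
theorem CNF.eval_flatMap (l : List ℕ) (f : ℕ → CNF ℕ) (σ : ℕ → Bool) :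
    CNF.eval (l.flatMap f) σ = l.all fun a => (f a).eval σ := by
  simp [CNF.eval, List.all_flatMap]

/-! ### The array multiplier: wires and clauses -/

namespace MulCNF

/-- The constant-`0` wire (fixed to `false` by a unit clause). [folklore] -/
def zeroVar : ℕ := 0

/-- The wire of input bit `xᵢ`. [folklore] -/
def xVar (i : ℕ) : ℕ := 6 * i + 1

/-- The wire of input bit `yⱼ`. [folklore] -/
def yVar (j : ℕ) : ℕ := 6 * j + 2

/-- The partial-product wire `pp_{j,i} ↔ xᵢ ∧ yⱼ` of cell `(j, i)` (`i, j < n`). [folklore] -/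
def ppVar (n j i : ℕ) : ℕ := 6 * (n * j + i) + 3

/-- The sum-output wire of the full adder of cell `(j, i)`. [folklore] -/
def sumVar (n j i : ℕ) : ℕ := 6 * (n * j + i) + 4

/-- The carry-output wire of the full adder of cell `(j, i)`. [folklore] -/
def carryVar (n j i : ℕ) : ℕ := 6 * (n * j + i) + 5

/-- The wire feeding the "accumulated bit" input of cell `(j, i)`: `0` in row `0`; in row `j + 1`
the output of row `j` shifted right by one, i.e. `sumVar n j (i+1)` for `i + 1 < n` and row
`j`'s top carry `carryVar n j (n-1)` for `i = n - 1`. [folklore] -/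
def aIn (n : ℕ) : ℕ → ℕ → ℕ
  | 0, _ => zeroVar
  | j + 1, i => if i + 1 < n then sumVar n j (i + 1) else carryVar n j (n - 1)

/-- The wire feeding the carry input of cell `(j, i)`: `0` for `i = 0`, else the carry-out of
cell `(j, i-1)` (ripple carry along the row). [folklore] -/
def cIn (n j : ℕ) : ℕ → ℕ
  | 0 => zeroVar
  | i + 1 => carryVar n j i

/-- The `2n` output wires of the `n × n` array multiplier, least significant first: the bit-`0`
sums of rows `0, …, n-2`, then all sums of the last row, then its top carry. [folklore] -/
def outVars : ℕ → List ℕ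
  | 0 => []
  | m + 1 => ((List.range m).map fun t => sumVar (m + 1) t 0) ++
      ((List.range (m + 1)).map fun i => sumVar (m + 1) m i) ++ [carryVar (m + 1) m m]

/-- There are `2n` output wires. [folklore] -/
@[simp] theorem length_outVars (n : ℕ) : (outVars n).length = 2 * n := by
  cases n with
  | zero => rfl
  | succ m => simp [outVars]; omega

/-- The AND-gate relation on `[a, b, c]`: `c = a ∧ b`. [folklore] -/
def andRel : List Bool → Bool
  | [a, b, c] => c == (a && b)
  | _ => true

/-- The full-adder sum relation on `[a, b, c, s]`: `s = a ⊕ b ⊕ c`. [folklore] -/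
def xor3Rel : List Bool → Bool
  | [a, b, c, s] => s == ((a ^^ b) ^^ c)
  | _ => true

/-- The full-adder carry relation on `[a, b, c, d]`: `d = maj(a, b, c)`. [folklore] -/
def majRel : List Bool → Bool
  | [a, b, c, d] => d == (a && b || a && c || b && c)
  | _ => true

/-- The clauses of cell `(j, i)`: the AND gate of the partial product and the two halves (sum,
carry) of the full adder, `4 + 8 + 8 = 20` clauses of width `≤ 4`. [Tseitin 1968 (clausal
translation of gates)] [cite: Tseitin1968] -/
def cellCNF (n j i : ℕ) : CNF ℕ :=
  relCNF [xVar i, yVar j, ppVar n j i] andRel ++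
    (relCNF [aIn n j i, ppVar n j i, cIn n j i, sumVar n j i] xor3Rel ++
      relCNF [aIn n j i, ppVar n j i, cIn n j i, carryVar n j i] majRel)

/-- All gate clauses of the `n × n` array multiplier: the unit clause `¬zeroVar` and the cells
`(j, i)`, `j, i < n`. [Tseitin 1968] [cite: Tseitin1968] -/
def gadgets (n : ℕ) : CNF ℕ :=
  [[(zeroVar, false)]] ++ (List.range n).flatMap fun j => (List.range n).flatMap fun i =>
    cellCNF n j i

/-- A cell has exactly `20` clauses. [folklore] -/
theorem length_cellCNF (n j i : ℕ) : (cellCNF n j i).length = 20 := by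
  simp only [cellCNF, List.length_append, relCNF, List.length_map, List.length_cons,
    List.length_nil]
  rfl

/-- `gadgets n` has `20 n² + 1` clauses. [folklore] -/
theorem length_gadgets (n : ℕ) : (gadgets n).length = 20 * n ^ 2 + 1 := by
  simp [gadgets, List.length_flatMap, length_cellCNF, List.map_const', List.sum_replicate]
  ring

/-- Every clause of a cell has width `≤ 4`. [folklore] -/
theorem isWidthLE_cellCNF (n j i : ℕ) : (cellCNF n j i).IsWidthLE 4 := by
  intro c hc
  simp only [cellCNF, List.mem_append] at hc
  rcases hc with hc | hc | hc
  · exact (isWidthLE_relCNF _ _ c hc).trans (by simp)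
  · exact isWidthLE_relCNF _ _ c hc
  · exact isWidthLE_relCNF _ _ c hc

/-- `gadgets n` has width `≤ 4`. [folklore] -/
theorem isWidthLE_gadgets (n : ℕ) : (gadgets n).IsWidthLE 4 := by
  intro c hc
  simp only [gadgets, List.mem_append, List.mem_singleton, List.mem_flatMap] at hc
  rcases hc with rfl | ⟨j, -, i, -, hc⟩
  · simp
  · exact isWidthLE_cellCNF n j i c hc

end MulCNF

open MulCNF in
/-- **The multiplier CNF `mulCNF n N`** ("`N ≡ x · y (mod 2²ⁿ)` for some `n`-bit `x, y ≠ 1`"): the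
gate clauses of the `n × n` array multiplier on inputs `xVar`, `yVar`, the unit clauses fixing its
`2n` output wires to the binary digits of `N`, and the clauses `x ≠ 1`, `y ≠ 1`. For a prime
`2ⁿ⁻¹ ≤ p < 2ⁿ` this is a clausal form of the Krajíček–Pudlák tautology `τ_p = ‖¬Composite‖(p̃)`,
`Composite(a) := ∃ u, v < a, u·v = a`; unsatisfiable iff `N` is prime when `2 ≤ N < 2ⁿ`
(`mulCNF_not_satisfiable_iff_prime`). [Krajíček–Pudlák 1998, §1 (Composite), §4 Thm. 12 (τ_p)]
[cite: KrajicekPudlak1998, §4, Thm. 12] -/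
def mulCNF (n N : ℕ) : CNF ℕ :=
  gadgets n ++ (fixBits (outVars n) N ++ (neOneCNF xVar n ++ neOneCNF yVar n))

open MulCNF in
/-- `mulCNF n N` has width `≤ max n 4` (only the two "`≠ 1`" clauses exceed `4`). [folklore] -/
theorem isWidthLE_mulCNF (n N : ℕ) : (mulCNF n N).IsWidthLE (max n 4) := by
  intro c hc
  simp only [mulCNF, List.mem_append] at hc
  rcases hc with hc | hc | hc | hc
  · exact (isWidthLE_gadgets n c hc).trans (le_max_right _ _)
  · exact (isWidthLE_fixBits _ _ c hc).trans (by omega)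
  · exact (isWidthLE_neOneCNF _ _ c hc).trans (le_max_left _ _)
  · exact (isWidthLE_neOneCNF _ _ c hc).trans (le_max_left _ _)

open MulCNF in
/-- `mulCNF n N` has exactly `20 n² + 2n + 3` clauses for `0 < n` (`20` per cell, `2n` output
units, `¬zeroVar`, `x ≠ 1`, `y ≠ 1`). [folklore] -/
theorem length_mulCNF {n : ℕ} (hn : 0 < n) (N : ℕ) :
    (mulCNF n N).length = 20 * n ^ 2 + 2 * n + 3 := by
  simp only [mulCNF, List.length_append, length_gadgets, length_fixBits, length_outVars,
    length_neOneCNF]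
  omega

/-- `mulCNF n N` has at most `20 n² + 2n + 3` clauses (all `n`). [folklore] -/
theorem length_mulCNF_le (n N : ℕ) : (mulCNF n N).length ≤ 20 * n ^ 2 + 2 * n + 3 := by
  simp only [mulCNF, List.length_append, MulCNF.length_gadgets, length_fixBits,
    MulCNF.length_outVars, length_neOneCNF]
  omega

/-! ### All variables are below `6 n²` -/

namespace MulCNF

/-- The variables owned by cell `(j, i)`, `j, i < n`, are `< 6 n²`. [folklore] -/
theorem cellBase_lt {n j i : ℕ} (hj : j < n) (hi : i < n) : 6 * (n * j + i) + 5 < 6 * n ^ 2 := by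
  have h := Nat.mul_le_mul_left n hj
  rw [Nat.mul_succ] at h
  rw [sq]
  omega

/-- `xVar i < 6 n²` for `i < n`. [folklore] -/
theorem xVar_lt {n i : ℕ} (hi : i < n) : xVar i < 6 * n ^ 2 := by
  have h := cellBase_lt hi hi
  unfold xVar
  nlinarith [Nat.zero_le (n * i)]

/-- `yVar j < 6 n²` for `j < n`. [folklore] -/
theorem yVar_lt {n j : ℕ} (hj : j < n) : yVar j < 6 * n ^ 2 := by
  have h := cellBase_lt hj hj
  unfold yVar
  nlinarith [Nat.zero_le (n * j)]

/-- `aIn n j i < 6 n²` for `j, i < n`. [folklore] -/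
theorem aIn_lt {n j i : ℕ} (hj : j < n) (hi : i < n) : aIn n j i < 6 * n ^ 2 := by
  cases j with
  | zero => have := cellBase_lt hj hi; simp only [aIn, zeroVar]; omega
  | succ j =>
    simp only [aIn]
    split_ifs with h
    · have := cellBase_lt (Nat.lt_of_succ_lt hj) h; unfold sumVar; omega
    · have := cellBase_lt (Nat.lt_of_succ_lt hj) (show n - 1 < n by omega); unfold carryVar; omega

/-- `cIn n j i < 6 n²` for `j, i < n`. [folklore] -/
theorem cIn_lt {n j i : ℕ} (hj : j < n) (hi : i < n) : cIn n j i < 6 * n ^ 2 := by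
  cases i with
  | zero => have := cellBase_lt hj hi; simp only [cIn, zeroVar]; omega
  | succ i => have := cellBase_lt hj (Nat.lt_of_succ_lt hi); simp only [cIn, carryVar]; omega

/-- Every variable of cell `(j, i)`, `j, i < n`, is `< 6 n²`. [folklore] -/
theorem fst_lt_of_mem_cellCNF {n j i : ℕ} (hj : j < n) (hi : i < n) {c : Clause ℕ}
    (hc : c ∈ cellCNF n j i) {l : Literal ℕ} (hl : l ∈ c) : l.1 < 6 * n ^ 2 := by
  have hb := cellBase_lt hj hi
  simp only [cellCNF, List.mem_append] at hc
  rcases hc with hc | hc | hc <;> have hm := fst_mem_of_mem_relCNF hc hl <;>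
    simp only [List.mem_cons, List.not_mem_nil, or_false] at hm
  · rcases hm with h | h | h <;> rw [h]
    · exact xVar_lt hi
    · exact yVar_lt hj
    · unfold ppVar; omega
  · rcases hm with h | h | h | h <;> rw [h]
    · exact aIn_lt hj hi
    · unfold ppVar; omega
    · exact cIn_lt hj hi
    · unfold sumVar; omega
  · rcases hm with h | h | h | h <;> rw [h]
    · exact aIn_lt hj hi
    · unfold ppVar; omega
    · exact cIn_lt hj hi
    · unfold carryVar; omega

/-- Every output wire is `< 6 n²`. [folklore] -/
theorem lt_of_mem_outVars {n v : ℕ} (hv : v ∈ outVars n) : v < 6 * n ^ 2 := by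
  cases n with
  | zero => simp [outVars] at hv
  | succ m =>
    simp only [outVars, List.mem_append, List.mem_map, List.mem_range, List.mem_singleton] at hv
    rcases hv with (⟨t, ht, rfl⟩ | ⟨i, hi, rfl⟩) | rfl
    · have := cellBase_lt (n := m + 1) (j := t) (i := 0) (by omega) (by omega)
      unfold sumVar; omega
    · have := cellBase_lt (n := m + 1) (j := m) (by omega) hi
      unfold sumVar; omega
    · have := cellBase_lt (n := m + 1) (j := m) (i := m) (by omega) (by omega)
      unfold carryVar; omega

end MulCNF

open MulCNF in
/-- **All variables of `mulCNF n N` are `< 6 n²`** (`0 < n`). [folklore] -/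
theorem fst_lt_of_mem_mulCNF {n : ℕ} (hn : 0 < n) {N : ℕ} {c : Clause ℕ} (hc : c ∈ mulCNF n N)
    {l : Literal ℕ} (hl : l ∈ c) : l.1 < 6 * n ^ 2 := by
  simp only [mulCNF, gadgets, List.mem_append, List.mem_singleton, List.mem_flatMap,
    List.mem_range] at hc
  rcases hc with (rfl | ⟨j, hj, i, hi, hc⟩) | hc | hc | hc
  · simp only [List.mem_singleton] at hl
    subst hl
    have := cellBase_lt hn hn
    simp only [zeroVar]
    omega
  · exact fst_lt_of_mem_cellCNF hj hi hc hl
  · exact lt_of_mem_outVars (fst_mem_of_mem_fixBits hc hl)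
  · obtain ⟨k, hk, h⟩ := exists_eq_of_mem_neOneCNF hc hl
    rw [h]; exact xVar_lt hk
  · obtain ⟨k, hk, h⟩ := exists_eq_of_mem_neOneCNF hc hl
    rw [h]; exact yVar_lt hk

/-- `mulCNF n N` has `numVars ≤ 6 n²` (`0 < n`): `O(n²)` variables, `O(n²)` clauses. [folklore] -/
theorem numVars_mulCNF_le {n : ℕ} (hn : 0 < n) (N : ℕ) : (mulCNF n N).numVars ≤ 6 * n ^ 2 :=
  CNF.numVars_le_of_forall_lt fun _ hc _ hl => fst_lt_of_mem_mulCNF hn hc hl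

/-! ### Semantics: what an assignment satisfying the gates computes -/

namespace MulCNF

variable {σ : ℕ → Bool} {n : ℕ}

/-- The gate constraints of the multiplier as equations between wire values under `σ`.
[folklore] -/
structure Gadgets (σ : ℕ → Bool) (n : ℕ) : Prop where
  /-- the constant wire is `0` -/
  zero : σ zeroVar = false
  /-- partial products are ANDs -/
  pp : ∀ j < n, ∀ i < n, σ (ppVar n j i) = (σ (xVar i) && σ (yVar j))
  /-- full-adder sums -/
  sum : ∀ j < n, ∀ i < n,
    σ (sumVar n j i) = ((σ (aIn n j i) ^^ σ (ppVar n j i)) ^^ σ (cIn n j i))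
  /-- full-adder carries -/
  carry : ∀ j < n, ∀ i < n,
    σ (carryVar n j i) = (σ (aIn n j i) && σ (ppVar n j i) || σ (aIn n j i) && σ (cIn n j i) ||
      σ (ppVar n j i) && σ (cIn n j i))

/-- A cell's clauses hold iff its three gate equations do. [Tseitin 1968] [cite: Tseitin1968] -/
theorem eval_cellCNF_iff (σ : ℕ → Bool) (n j i : ℕ) :
    (cellCNF n j i).eval σ = true ↔
      σ (ppVar n j i) = (σ (xVar i) && σ (yVar j)) ∧
      σ (sumVar n j i) = ((σ (aIn n j i) ^^ σ (ppVar n j i)) ^^ σ (cIn n j i)) ∧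
      σ (carryVar n j i) = (σ (aIn n j i) && σ (ppVar n j i) ||
        σ (aIn n j i) && σ (cIn n j i) || σ (ppVar n j i) && σ (cIn n j i)) := by
  simp [cellCNF, CNF.eval_append, eval_relCNF_iff, andRel, xor3Rel, majRel]

/-- **`gadgets n` means `Gadgets`.** [Tseitin 1968] [cite: Tseitin1968] -/
theorem eval_gadgets_iff (σ : ℕ → Bool) (n : ℕ) : (gadgets n).eval σ = true ↔ Gadgets σ n := by
  have h0 : CNF.eval [[(zeroVar, false)]] σ = true ↔ σ zeroVar = false := by
    simp [CNF.eval, Literal.eval]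
  rw [gadgets, CNF.eval_append, Bool.and_eq_true, h0, CNF.eval_flatMap]
  simp only [List.all_eq_true, List.mem_range, CNF.eval_flatMap, eval_cellCNF_iff]
  constructor
  · rintro ⟨hz, h⟩
    exact ⟨hz, fun j hj i hi => (h j hj i hi).1, fun j hj i hi => (h j hj i hi).2.1,
      fun j hj i hi => (h j hj i hi).2.2⟩
  · rintro ⟨hz, hp, hs, hc⟩
    exact ⟨hz, fun j hj i hi => ⟨hp j hj i hi, hs j hj i hi, hc j hj i hi⟩⟩

/-- The `(n+1)`-bit output of row `j` under `σ`: its `n` sum bits and its top carry.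
(`n - 1` is only used for `0 < n`.) [folklore] -/
def rowVal (σ : ℕ → Bool) (n j : ℕ) : ℕ :=
  natOfBits (fun i => σ (sumVar n j i)) n + 2 ^ n * (σ (carryVar n j (n - 1))).toNat

/-- Each row adds: row `j`'s output is its accumulated input plus `yⱼ · x`.
[folklore] -/
theorem Gadgets.rowVal_eq (h : Gadgets σ n) {j : ℕ} (hj : j < n) :
    rowVal σ n j = natOfBits (fun i => σ (aIn n j i)) n +
      (σ (yVar j)).toNat * natOfBits (fun i => σ (xVar i)) n := by
  have hrip := ripple_adder (a := fun i => σ (aIn n j i)) (p := fun i => σ (ppVar n j i))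
    (s := fun i => σ (sumVar n j i)) (κ := fun i => σ (cIn n j i)) (m := n) (fun i hi => by
      rw [h.sum j hj i hi, show cIn n j (i + 1) = carryVar n j i from rfl, h.carry j hj i hi]
      exact fullAdder_arith _ _ _)
  have hpp : natOfBits (fun i => σ (ppVar n j i)) n =
      (σ (yVar j)).toNat * natOfBits (fun i => σ (xVar i)) n := by
    rw [← natOfBits_and]
    exact natOfBits_congr fun i hi => h.pp j hj i hi
  have hκ0 : σ (cIn n j 0) = false := h.zero
  obtain ⟨m, rfl⟩ : ∃ m, n = m + 1 := ⟨n - 1, by omega⟩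
  have hκn : cIn (m + 1) j (m + 1) = carryVar (m + 1) j (m + 1 - 1) := rfl
  rw [hκ0, hκn, hpp] at hrip
  rw [rowVal, ← hrip]
  simp

/-- Row `j + 1` reads row `j`'s output shifted right: `rowVal j = sum_{j,0} + 2 · (input of row j+1)`.
[folklore] -/
theorem rowVal_eq_shift (σ : ℕ → Bool) {n : ℕ} (hn : 0 < n) (j : ℕ) :
    rowVal σ n j = (σ (sumVar n j 0)).toNat + 2 * natOfBits (fun i => σ (aIn n (j + 1) i)) n := by
  obtain ⟨m, rfl⟩ : ∃ m, n = m + 1 := ⟨n - 1, by omega⟩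
  rw [rowVal, natOfBits_succ', natOfBits_succ]
  have h1 : natOfBits (fun i => σ (aIn (m + 1) (j + 1) i)) m =
      natOfBits (fun i => σ (sumVar (m + 1) j (i + 1))) m :=
    natOfBits_congr fun i hi => by simp [aIn, hi]
  have h2 : aIn (m + 1) (j + 1) m = carryVar (m + 1) j m := by simp [aIn]
  rw [h1, h2, Nat.add_sub_cancel, pow_succ]
  ring

/-- **The multiplier invariant**: after row `j < n`,
`2ʲ · rowVal j + Σ_{t<j} sum_{t,0} 2ᵗ = x · (y mod 2ʲ⁺¹)`. [folklore] -/
theorem Gadgets.acc_eq (h : Gadgets σ n) :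
    ∀ j < n, 2 ^ j * rowVal σ n j + natOfBits (fun t => σ (sumVar n t 0)) j =
      natOfBits (fun i => σ (xVar i)) n * natOfBits (fun t => σ (yVar t)) (j + 1) := by
  intro j
  induction j with
  | zero =>
    intro h0
    rw [h.rowVal_eq h0, natOfBits_succ, natOfBits_zero, natOfBits_zero]
    have : natOfBits (fun i => σ (aIn n 0 i)) n = 0 := by
      rw [← natOfBits_false n]
      exact natOfBits_congr fun i _ => by simp [aIn, h.zero]
    rw [this]
    ring
  | succ j ih =>
    intro hj1
    have hj : j < n := Nat.lt_of_succ_lt hj1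
    have ih' := ih hj
    have hR1 := h.rowVal_eq hj1
    have hRj := rowVal_eq_shift σ (Nat.zero_lt_of_lt hj) j
    rw [natOfBits_succ, natOfBits_succ _ (j + 1), hR1]
    rw [hRj] at ih'
    simp only [pow_succ] at ih' ⊢
    linear_combination ih'

/-- **Soundness of the array multiplier**: under any assignment satisfying the gates, the
number on the output wires is the product of the numbers on the input wires. [folklore] -/
theorem Gadgets.out_eq (h : Gadgets σ n) :
    bitsToNat ((outVars n).map σ) =
      natOfBits (fun i => σ (xVar i)) n * natOfBits (fun j => σ (yVar j)) n := by
  cases n with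
  | zero => simp [outVars]
  | succ m =>
    have key := h.acc_eq m (Nat.lt_succ_self m)
    rw [rowVal, Nat.add_sub_cancel] at key
    simp only [outVars, List.map_append, List.map_map, List.map_cons, List.map_nil,
      bitsToNat_append, bitsToNat_cons, bitsToNat_nil, List.length_append, List.length_map,
      List.length_range, Function.comp_def]
    simp only [natOfBits] at key ⊢
    linear_combination key

/-! ### Completeness: the intended assignment -/

/-- A full adder: `(sum, carry)` of three bits. [folklore] -/
def fa (a b c : Bool) : Bool × Bool :=
  ((a ^^ b) ^^ c, a && b || a && c || b && c)

/-- One ripple-carry row: cell `i` adds `a i`, `p i` and the carry-out of cell `i - 1` (`0` for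
`i = 0`); returns `(sum, carry-out)` of cell `i`. [folklore] -/
def rowCells (a p : ℕ → Bool) : ℕ → Bool × Bool
  | 0 => fa (a 0) (p 0) false
  | i + 1 => fa (a (i + 1)) (p (i + 1)) (rowCells a p i).2

/-- The `(sum, carry)` values of all cells `(j, i)` of the `n × n` array multiplier on input bits
`xb`, `yb`, following the wiring `aIn` / `cIn`. [folklore] -/
def cells (n : ℕ) (xb yb : ℕ → Bool) : ℕ → ℕ → Bool × Bool
  | 0 => rowCells (fun _ => false) fun i => xb i && yb 0
  | j + 1 => rowCells
      (fun i => if i + 1 < n then (cells n xb yb j (i + 1)).1 else (cells n xb yb j (n - 1)).2)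
      fun i => xb i && yb (j + 1)

/-- The value on the accumulated-bit input of cell `(j, i)` (mirrors `aIn`). [folklore] -/
def aVal (n : ℕ) (xb yb : ℕ → Bool) : ℕ → ℕ → Bool
  | 0, _ => false
  | j + 1, i => if i + 1 < n then (cells n xb yb j (i + 1)).1 else (cells n xb yb j (n - 1)).2

/-- The value on the carry input of cell `(j, i)` (mirrors `cIn`). [folklore] -/
def cVal (n : ℕ) (xb yb : ℕ → Bool) (j : ℕ) : ℕ → Bool
  | 0 => false
  | i + 1 => (cells n xb yb j i).2

/-- Every cell is the full adder of its three inputs. [folklore] -/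
theorem cells_eq (n : ℕ) (xb yb : ℕ → Bool) (j i : ℕ) :
    cells n xb yb j i = fa (aVal n xb yb j i) (xb i && yb j) (cVal n xb yb j i) := by
  cases j <;> cases i <;> simp [cells, rowCells, aVal, cVal]

/-- The intended assignment for the factorisation `x · y`: decode a variable `v` by `v % 6`
(which kind of wire) and `v / 6 = n·j + i` (which cell). [folklore] -/
def witness (n x y v : ℕ) : Bool :=
  if v % 6 = 1 then x.testBit (v / 6)
  else if v % 6 = 2 then y.testBit (v / 6)
  else if v % 6 = 3 then x.testBit (v / 6 % n) && y.testBit (v / 6 / n)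
  else if v % 6 = 4 then (cells n x.testBit y.testBit (v / 6 / n) (v / 6 % n)).1
  else if v % 6 = 5 then (cells n x.testBit y.testBit (v / 6 / n) (v / 6 % n)).2
  else false

variable {x y : ℕ}

/-- `witness` on the zero wire. [folklore] -/
@[simp] theorem witness_zeroVar (n x y : ℕ) : witness n x y zeroVar = false := by
  simp [witness, zeroVar]

/-- `witness` on `xVar i` is bit `i` of `x`. [folklore] -/
@[simp] theorem witness_xVar (n x y i : ℕ) : witness n x y (xVar i) = x.testBit i := by
  have h1 : (6 * i + 1) % 6 = 1 := by omega
  have h2 : (6 * i + 1) / 6 = i := by omega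
  simp [witness, xVar, h1, h2]

/-- `witness` on `yVar j` is bit `j` of `y`. [folklore] -/
@[simp] theorem witness_yVar (n x y j : ℕ) : witness n x y (yVar j) = y.testBit j := by
  have h1 : (6 * j + 2) % 6 = 2 := by omega
  have h2 : (6 * j + 2) / 6 = j := by omega
  simp [witness, yVar, h1, h2]

/-- Decoding the column of cell `(j, i)` from `n·j + i` (`i < n`). [folklore] -/
private theorem decode_mod {n j i : ℕ} (hi : i < n) : (n * j + i) % n = i := by
  rw [Nat.mul_add_mod]; exact Nat.mod_eq_of_lt hi

/-- Decoding the row of cell `(j, i)` from `n·j + i` (`i < n`). [folklore] -/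
private theorem decode_div {n j i : ℕ} (hi : i < n) : (n * j + i) / n = j := by
  rw [Nat.mul_add_div (Nat.zero_lt_of_lt hi), Nat.div_eq_of_lt hi, Nat.add_zero]

/-- `witness` on a partial-product wire. [folklore] -/
theorem witness_ppVar (x y : ℕ) {n j i : ℕ} (hi : i < n) :
    witness n x y (ppVar n j i) = (x.testBit i && y.testBit j) := by
  have h1 : (6 * (n * j + i) + 3) % 6 = 3 := by omega
  have h2 : (6 * (n * j + i) + 3) / 6 = n * j + i := by omega
  simp [witness, ppVar, h1, h2, decode_mod hi, decode_div hi]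

/-- `witness` on a sum wire. [folklore] -/
theorem witness_sumVar (x y : ℕ) {n j i : ℕ} (hi : i < n) :
    witness n x y (sumVar n j i) = (cells n x.testBit y.testBit j i).1 := by
  have h1 : (6 * (n * j + i) + 4) % 6 = 4 := by omega
  have h2 : (6 * (n * j + i) + 4) / 6 = n * j + i := by omega
  simp [witness, sumVar, h1, h2, decode_mod hi, decode_div hi]

/-- `witness` on a carry wire. [folklore] -/
theorem witness_carryVar (x y : ℕ) {n j i : ℕ} (hi : i < n) :
    witness n x y (carryVar n j i) = (cells n x.testBit y.testBit j i).2 := by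
  have h1 : (6 * (n * j + i) + 5) % 6 = 5 := by omega
  have h2 : (6 * (n * j + i) + 5) / 6 = n * j + i := by omega
  simp [witness, carryVar, h1, h2, decode_mod hi, decode_div hi]

/-- `witness` on the accumulated-bit input of a cell is `aVal`. [folklore] -/
theorem witness_aIn (x y : ℕ) {n j i : ℕ} (hj : j ≤ n) (hi : i < n) :
    witness n x y (aIn n j i) = aVal n x.testBit y.testBit j i := by
  cases j with
  | zero => simp [aIn, aVal]
  | succ j =>
    simp only [aIn, aVal]
    split_ifs with h
    · exact witness_sumVar x y h
    · exact witness_carryVar x y (by omega)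

/-- `witness` on the carry input of a cell is `cVal`. [folklore] -/
theorem witness_cIn (x y : ℕ) {n j i : ℕ} (hi : i < n) :
    witness n x y (cIn n j i) = cVal n x.testBit y.testBit j i := by
  cases i with
  | zero => simp [cIn, cVal]
  | succ i => exact witness_carryVar x y (Nat.lt_of_succ_lt hi)

/-- **Completeness of the gate clauses**: the intended assignment satisfies every gate.
[folklore] -/
theorem gadgets_witness (n x y : ℕ) : Gadgets (witness n x y) n where
  zero := witness_zeroVar n x y
  pp j _ i hi := by rw [witness_ppVar x y hi, witness_xVar, witness_yVar]
  sum j hj i hi := by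
    rw [witness_sumVar x y hi, witness_aIn x y hj.le hi, witness_ppVar x y hi,
      witness_cIn x y hi, cells_eq, fa]
  carry j hj i hi := by
    rw [witness_carryVar x y hi, witness_aIn x y hj.le hi, witness_ppVar x y hi,
      witness_cIn x y hi, cells_eq, fa]

/-- The input wires of `witness n x y` carry `x mod 2ⁿ` and `y mod 2ⁿ`. [folklore] -/
theorem natOfBits_witness_xVar (n x y : ℕ) :
    natOfBits (fun i => witness n x y (xVar i)) n = x % 2 ^ n := by
  simp only [witness_xVar]
  exact natOfBits_testBit x n

/-- The input wires of `witness n x y` carry `x mod 2ⁿ` and `y mod 2ⁿ`. [folklore] -/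
theorem natOfBits_witness_yVar (n x y : ℕ) :
    natOfBits (fun j => witness n x y (yVar j)) n = y % 2 ^ n := by
  simp only [witness_yVar]
  exact natOfBits_testBit y n

end MulCNF

/-! ### The main theorems -/

open MulCNF

/-- What `mulCNF n N` says of an assignment: the gates hold, the output wires spell
`N mod 2²ⁿ`, and neither input is `1`. [folklore] -/
theorem eval_mulCNF_iff (σ : ℕ → Bool) (n N : ℕ) :
    (mulCNF n N).eval σ = true ↔
      Gadgets σ n ∧ bitsToNat ((outVars n).map σ) = N % 2 ^ (2 * n) ∧
        natOfBits (fun i => σ (xVar i)) n ≠ 1 ∧ natOfBits (fun j => σ (yVar j)) n ≠ 1 := by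
  simp only [mulCNF, CNF.eval_append, Bool.and_eq_true, eval_gadgets_iff, eval_fixBits_iff,
    length_outVars, eval_neOneCNF_iff]

/-- **`mulCNF n N` is satisfiable iff `N ≡ x · y (mod 2²ⁿ)` for some `x, y < 2ⁿ`, both `≠ 1`.**
[Krajíček–Pudlák 1998, §1, §4 (¬Composite)] [cite: KrajicekPudlak1998, §4, Thm. 12] -/
theorem mulCNF_satisfiable_iff (n N : ℕ) :
    (mulCNF n N).Satisfiable ↔
      ∃ x y : ℕ, x < 2 ^ n ∧ y < 2 ^ n ∧ x ≠ 1 ∧ y ≠ 1 ∧ x * y = N % 2 ^ (2 * n) := by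
  constructor
  · rintro ⟨σ, hσ⟩
    obtain ⟨hg, hout, hx, hy⟩ := (eval_mulCNF_iff σ n N).1 hσ
    exact ⟨_, _, natOfBits_lt _ n, natOfBits_lt _ n, hx, hy, by rw [← hg.out_eq, hout]⟩
  · rintro ⟨x, y, hx, hy, hx1, hy1, hxy⟩
    refine ⟨witness n x y, (eval_mulCNF_iff _ n N).2 ⟨gadgets_witness n x y, ?_, ?_, ?_⟩⟩
    · rw [(gadgets_witness n x y).out_eq, natOfBits_witness_xVar, natOfBits_witness_yVar,
        Nat.mod_eq_of_lt hx, Nat.mod_eq_of_lt hy, hxy]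
    · rwa [natOfBits_witness_xVar, Nat.mod_eq_of_lt hx]
    · rwa [natOfBits_witness_yVar, Nat.mod_eq_of_lt hy]

/-- For `N < 2²ⁿ`: `mulCNF n N` is satisfiable iff `N = x · y` with `x, y < 2ⁿ`, both `≠ 1`.
[Krajíček–Pudlák 1998, §1, §4] [cite: KrajicekPudlak1998, §4, Thm. 12] -/
theorem mulCNF_satisfiable_iff_of_lt {n N : ℕ} (hN : N < 2 ^ (2 * n)) :
    (mulCNF n N).Satisfiable ↔
      ∃ x y : ℕ, x < 2 ^ n ∧ y < 2 ^ n ∧ x ≠ 1 ∧ y ≠ 1 ∧ x * y = N := by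
  rw [mulCNF_satisfiable_iff, Nat.mod_eq_of_lt hN]

/-- **The primality CNFs**: for `2 ≤ N < 2ⁿ`, `mulCNF n N` is unsatisfiable iff `N` is prime (so
for a prime `2ⁿ⁻¹ ≤ p < 2ⁿ`, `mulCNF n p` is an unsatisfiable CNF expressing `¬Composite(p)`, a
clausal form of the Krajíček–Pudlák tautology `τ_p`). [Krajíček–Pudlák 1998, §4, Thm. 12 and the
Problem after it] [cite: KrajicekPudlak1998, §4, Thm. 12] -/
theorem mulCNF_not_satisfiable_iff_prime {n N : ℕ} (h2 : 2 ≤ N) (hN : N < 2 ^ n) :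
    ¬ (mulCNF n N).Satisfiable ↔ N.Prime := by
  have hN2 : N < 2 ^ (2 * n) :=
    hN.trans_le (Nat.pow_le_pow_right (by norm_num) (by omega))
  rw [mulCNF_satisfiable_iff_of_lt hN2]
  constructor
  · intro h
    by_contra hp
    obtain ⟨m, ⟨k, rfl⟩, hm2, hmN⟩ := (Nat.not_prime_iff_exists_dvd_lt h2).1 hp
    refine h ⟨m, k, by omega, ?_, by omega, ?_, rfl⟩
    · have : k ≤ m * k := Nat.le_mul_of_pos_left k (by omega)
      omega
    · rintro rfl
      simp at hmN
  · rintro hp ⟨x, y, -, -, hx1, hy1, hxy⟩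
    rcases hp.eq_one_or_self_of_dvd x ⟨y, hxy.symm⟩ with rfl | rfl
    · exact hx1 rfl
    · have hx0 : 0 < x := by omega
      exact hy1 (Nat.eq_of_mul_eq_mul_left hx0 (hxy.trans (mul_one x).symm))

end Literature.Computability.Complexity
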